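import Summits.BirchSwinnertonDyer.BirchSwinnertonDyer.Theorems.ByReductionTypeAtTwoAdditiveCubicResolventAnalytic
import Literature.NumberTheory.EllipticCurves.Milne1972.WeilRestrictionQuadraticBSDQuotientAnyModel
import Literature.NumberTheory.EllipticCurves.BSDSelmerParityDokchitserProp417Proofs
import HarnessLib

/-!
# Route `ByReductionTypeAtTwo` (rung K4), crux `AdditiveRankZeroAtTwo` (item
# stmt-BirchSwinnertonDyer-19098): the CUBIC-RESOLVENT DESCENT, part 2 — the ALGEBRAIC side
# (Dokchitser–Dokchitser 2010 Thm. 2.3 twice) and the MAIN IDENTITY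

HONEST FRAMING (cell `bsd-2adic`, run/shared/lean/pub/bsd-2adic/, HUMAN RULINGS D-0036/D-0074;
seat `bsd-2adic-addL2x` GEN 3, WIDTH-LEVER lane B «semistable base change to the field of good
reduction + Kato over that field + norm descent»): theorems only; NO new definition, NO new named
fact in this file (the PRINT inputs are consumed BY NAME: modularity `hmod`, Milne 1972 `hMilneC`,
Dokchitser–Dokchitser 2010 Thm. 2.3 `hDD`, Artin formalism `hArtin`, base change for `GL(2)`
`hBC3`/`hBC6` — the last four from `Literature/…/CubicResolventArtinFormalismBSDQuotient.lean`,
p544626); nothing asserted; no class closed; nothing booked; BSD is not proved by any of this.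
PARTITION (D-0054): X5@2 ADDITIVE, defect-`≥ 3` sub-class (B1·O1; 1 382 classes; the odd core `C₃`
454 is where the reading «good reduction over `F`» applies) × p = 2 — types-the-object-of; closes
none. bears_on: K4 (crux `AdditiveRankZeroAtTwo`, item stmt-BirchSwinnertonDyer-19098).

WHAT THIS FILE PROVES. In the `S₃` configuration (`K` quadratic, `F` cubic with `d_F = d_K f²`,
`L ⊇ F, K` Galois of degree `6`), for globally minimal `W`, `Wd` (`Wd` a model of `W^{(d_K)}`) and
ANY models `VF`, `VF'` of `W_F`, `Wd_F` with the four `Ш` finite: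
* `quotient_sq_eq` — `(BSDq(VF)·RHS(Wd))² = (RHS(W)·BSDq(VF'))²` for Dokchitser–Dokchitser's
  Birch–Swinnerton-Dyer quotients (`#Ш·Reg·Ω(ω)·C(ω)/#tors²`, the tree's `modifiedTamagawaProduct`
  currency of `Milne1972.bsdQuotient_baseChange_quadratic_anyModel`): Milne's quadratic identity
  makes `Ш(E_K)` finite with `BSDq(E_K) = RHS(W)·RHS(Wd) > 0`, and Dokchitser–Dokchitser Thm. 2.3
  for the `S₃` relation (`DokchitserDokchitser2010.bsdQuotient_brauerS3_anyModel`), for `E` and for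
  `E^{(d_K)}` on the SAME models over `K` and `L`, gives two relations whose quotient is the claim —
  the abelian surface `E ⊗ ρ` never appears;
* `sha_sq_identity` — with part 1's analytic identity:
  `(#Ш_an(W)·#Ш_an(VF')·#Ш(Wd)·#Ш(VF))² = (#Ш_an(Wd)·#Ш_an(VF)·#Ш(W)·#Ш(VF'))²` in `ℂ`
  (`#Ш_an` over `ℚ` = the tree's `shaAn`, over `F` = `AdditivePotMult.shaAnOverC`), i.e. the BSD
  truth-ratios satisfy `ρ(E/ℚ)/ρ(E^{(D)}/ℚ) = ± ρ(E_F)/ρ(E^{(D)}_F)`.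
The squares (sign ambiguity) are harmless: only `p`-adic valuations are read off (part 3).

References: [DokchitserDokchitserAnnals2010] §2.1 statement 2.1, Thm. 2.3, §2.4; [Milne1972ArithmeticAV]
§1 Thm. 1; [MilneADT2006] I.7.3.
-/

set_option autoImplicit false
-- the Theorems namespace of this sub repeats the summit name by design (D-0017 nested layout)
set_option linter.dupNamespace false

noncomputable section

open scoped Classical

open WeierstrassCurve Literature.NumberTheory.EllipticCurves
  Literature.NumberTheory.EllipticCurves.Rank1Residual
  Literature.NumberTheory.EllipticCurves.Rank1Residual.Typed
  Summit.BirchSwinnertonDyer.Rank1Residual.AdditivePotMult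

namespace Summit.BirchSwinnertonDyer.BirchSwinnertonDyer.Theorems.CubicResolvent

/-! ## §4 The algebraic side (Dokchitser–Dokchitser Thm. 2.3 twice) and the MAIN IDENTITY -/

section Main

open Literature.NumberTheory.QuadraticFields

variable (W : WeierstrassCurve ℚ) [W.IsElliptic] [W.IsGloballyMinimal]
  (Wd : WeierstrassCurve ℚ) [Wd.IsElliptic] [Wd.IsGloballyMinimal]
  (K : Type) [Field K] [NumberField K] (F : Type) [Field F] [NumberField F]
  (L : Type) [Field L] [NumberField L] [Algebra F L] [Algebra K L]
  (VF : WeierstrassCurve F) [VF.IsElliptic] (VF' : WeierstrassCurve F) [VF'.IsElliptic]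

omit [W.IsGloballyMinimal] in
/-- `#Ш_an(W) · RHS(W) = ℓ(W) · #Ш(W)` over `ℚ` (unfolding `shaAn`, `bsdRHS`; the period, Tamagawa
product, regulator and torsion order are positive). [folklore] -/
theorem shaAn_mul_bsdRHS : shaAn W * (W.bsdRHS : ℂ) = W.leadingLCoeff * (W.shaOrder : ℂ) := by
  have hΩ : (W.realPeriodRat : ℂ) ≠ 0 := by exact_mod_cast W.realPeriodRat_pos_holds.ne'
  have hc : (W.tamagawaProduct : ℂ) ≠ 0 := by exact_mod_cast (W.tamagawaProduct_pos_holds).ne'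
  have hR : (W.regulator : ℂ) ≠ 0 := by exact_mod_cast W.regulator_pos'.ne'
  have ht : (W.torsionOrder : ℂ) ≠ 0 := by exact_mod_cast W.torsionOrder_pos_holds.ne'
  rw [shaAn_def, bsdRHS_def]
  push_cast
  field_simp

omit [Algebra F L] [Algebra K L] [NumberField L] [Field L] in
/-- `#Ш_an(V) · BSD-quotient(V) = ℓ(V) · #Ш(V)` on any model `V` over a number field `M`
(unfolding `shaAnOverC`; `Ω(ω_V)`, `C(ω_V)`, `Reg`, `#tors` positive). [folklore] -/
theorem shaAnOverC_mul_quotient {M : Type} [Field M] [NumberField M] (V : WeierstrassCurve M)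
    [V.IsElliptic] :
    shaAnOverC V * (((V.shaOrder : ℝ) * V.regulator * V.bsdPeriod * (V.modifiedTamagawaProduct : ℝ) /
        (V.torsionOrder : ℝ) ^ 2 : ℝ) : ℂ) = V.leadingLCoeff * (V.shaOrder : ℂ) := by
  have hΩ : (V.bsdPeriod : ℂ) ≠ 0 := by exact_mod_cast V.bsdPeriod_pos'.ne'
  have hc : (V.modifiedTamagawaProduct : ℂ) ≠ 0 := by
    exact_mod_cast (V.modifiedTamagawaProduct_pos).ne'
  have hR : (V.regulator : ℂ) ≠ 0 := by exact_mod_cast V.regulator_pos'.ne'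
  have ht : (V.torsionOrder : ℂ) ≠ 0 := by exact_mod_cast V.torsionOrder_pos_holds.ne'
  rw [shaAnOverC]
  push_cast
  field_simp

omit [W.IsElliptic] [W.IsGloballyMinimal] [Wd.IsElliptic] [Wd.IsGloballyMinimal] [VF.IsElliptic]
  [Algebra F L] [Algebra K L] [NumberField L] [Field L] [NumberField K] [Field K] in
/-- The BSD quotient of an elliptic model over a number field with finite `Ш` is positive. [folklore] -/
theorem quotient_pos {M : Type} [Field M] [NumberField M] (V : WeierstrassCurve M) [V.IsElliptic]
    (hV : V.ShaFinite) :
    0 < (V.shaOrder : ℝ) * V.regulator * V.bsdPeriod * (V.modifiedTamagawaProduct : ℝ) /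
        (V.torsionOrder : ℝ) ^ 2 := by
  have hs : (0 : ℝ) < V.shaOrder := Nat.cast_pos.mpr (V.shaOrder_pos hV)
  have hR : (0 : ℝ) < V.regulator := V.regulator_pos'
  have hΩ : (0 : ℝ) < V.bsdPeriod := V.bsdPeriod_pos'
  have hc : (0 : ℝ) < V.modifiedTamagawaProduct := by exact_mod_cast V.modifiedTamagawaProduct_pos
  have ht : (0 : ℝ) < V.torsionOrder := Nat.cast_pos.mpr V.torsionOrder_pos_holds
  positivity

/-- **Algebraic side: the abelian surface cancels.** In the `S₃` configuration, for `W`, `Wd`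
globally minimal models of `E`, `E^{(d_K)}` and models `VF`, `VF'` of `E_F`, `E^{(d_K)}_F`, with
`Ш(E/ℚ), Ш(E^{(d_K)}/ℚ), Ш(E/F), Ш(E^{(d_K)}/F)` finite:
`(BSDq(VF) · RHS(Wd))² = (RHS(W) · BSDq(VF'))²`. Proof: Milne's quadratic identity
(`hMilneC`) makes `Ш(E/K)` finite with `BSDq(E_K) = RHS(W)·RHS(Wd) > 0`; Dokchitser–Dokchitser
Thm. 2.3 for the `S₃` relation (`hDD`) applied to `E` and — with `E^{(d_K)}_K ≅ E_K`,
`E^{(d_K)}_L ≅ E_L` — to `E^{(d_K)}` gives `BSDq(E_L)·RHS(W)² = BSDq(E_K)·BSDq(VF)²` and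
`BSDq(E_L)·RHS(Wd)² = BSDq(E_K)·BSDq(VF')²`; eliminate `BSDq(E_L)`. [folklore] -/
theorem quotient_sq_eq (hMilneC : Milne1972.bsdQuotient_baseChange_quadratic_anyModel)
    (hDD : DokchitserDokchitser2010.bsdQuotient_brauerS3_anyModel)
    (hK2 : Module.finrank ℚ K = 2) (hF3 : Module.finrank ℚ F = 3) {f : ℤ} (hf : f ≠ 0)
    (hdisc : NumberField.discr F = NumberField.discr K * f ^ 2)
    (hL6 : Module.finrank ℚ L = 6) (hGal : IsGalois ℚ L)
    (hWd : ∃ C : VariableChange ℚ, C • W.quadraticTwist (NumberField.discr K : ℚ) = Wd)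
    (hVF : ∃ C : VariableChange F, C • W.baseChange F = VF)
    (hVF' : ∃ C : VariableChange F, C • Wd.baseChange F = VF')
    (hshaW : W.ShaFinite) (hshaWd : Wd.ShaFinite) (hshaF : VF.ShaFinite)
    (hshaF' : VF'.ShaFinite) :
    ((VF.shaOrder : ℝ) * VF.regulator * VF.bsdPeriod * (VF.modifiedTamagawaProduct : ℝ) /
        (VF.torsionOrder : ℝ) ^ 2 * Wd.bsdRHS) ^ 2 =
      (W.bsdRHS * ((VF'.shaOrder : ℝ) * VF'.regulator * VF'.bsdPeriod *
        (VF'.modifiedTamagawaProduct : ℝ) / (VF'.torsionOrder : ℝ) ^ 2)) ^ 2 := by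
  haveI : (W.baseChange K).IsElliptic := by rw [baseChange]; infer_instance
  haveI : (W.baseChange L).IsElliptic := by rw [baseChange]; infer_instance
  obtain ⟨hshaK, hWR⟩ := hMilneC W K hK2 Wd hWd (W.baseChange K) ⟨1, one_smul _ _⟩ hshaW hshaWd
  obtain ⟨-, e1⟩ := hDD W K hK2 F hF3 f hf hdisc L hL6 hGal VF hVF (W.baseChange K)
    ⟨1, one_smul _ _⟩ (W.baseChange L) ⟨1, one_smul _ _⟩ hshaW hshaK hshaF
  obtain ⟨CK, hCK⟩ := exists_variableChange_twist_baseChange_quadratic W Wd K hK2 hWd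
  obtain ⟨CL, hCL⟩ := exists_variableChange_twist_baseChange_ext W Wd K L hK2 hWd
  obtain ⟨-, e2⟩ := hDD Wd K hK2 F hF3 f hf hdisc L hL6 hGal VF' hVF' (W.baseChange K)
    ⟨CK, hCK⟩ (W.baseChange L) ⟨CL, hCL⟩ hshaWd hshaK hshaF'
  have hAK : (((W.baseChange K).shaOrder : ℝ) * (W.baseChange K).regulator *
      (W.baseChange K).bsdPeriod * ((W.baseChange K).modifiedTamagawaProduct : ℝ) /
        ((W.baseChange K).torsionOrder : ℝ) ^ 2) ≠ 0 := by
    rw [hWR]; exact (mul_pos (W.bsdRHS_pos' hshaW) (Wd.bsdRHS_pos' hshaWd)).ne'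
  have key : (((W.baseChange K).shaOrder : ℝ) * (W.baseChange K).regulator *
      (W.baseChange K).bsdPeriod * ((W.baseChange K).modifiedTamagawaProduct : ℝ) /
        ((W.baseChange K).torsionOrder : ℝ) ^ 2) *
      (((VF.shaOrder : ℝ) * VF.regulator * VF.bsdPeriod * (VF.modifiedTamagawaProduct : ℝ) /
        (VF.torsionOrder : ℝ) ^ 2 * Wd.bsdRHS) ^ 2 -
      (W.bsdRHS * ((VF'.shaOrder : ℝ) * VF'.regulator * VF'.bsdPeriod *
        (VF'.modifiedTamagawaProduct : ℝ) / (VF'.torsionOrder : ℝ) ^ 2)) ^ 2) = 0 := by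
    linear_combination (-(Wd.bsdRHS ^ 2)) * e1 + W.bsdRHS ^ 2 * e2
  exact sub_eq_zero.mp ((mul_eq_zero.mp key).resolve_left hAK)

/-- **MAIN IDENTITY (the cubic-resolvent descent, any models).** In the `S₃` configuration, with
the PRINT inputs modularity (`hmod`), Milne 1972 (`hMilneC`), Dokchitser–Dokchitser 2010 Thm. 2.3
(`hDD`), Artin formalism (`hArtin`) and base-change holomorphy (`hBC3`, `hBC6`), and finiteness of
the four `Ш`:
`(#Ш_an(W) · #Ш_an(VF') · #Ш(Wd) · #Ш(VF))² = (#Ш_an(Wd) · #Ш_an(VF) · #Ш(W) · #Ш(VF'))²` in `ℂ`,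
i.e. the BSD truth-ratios satisfy `ρ(E/ℚ)/ρ(E^{(D)}/ℚ) = ± ρ(E_F)/ρ(E^{(D)}_F)` — the complement
`E ⊗ ρ` of `Res_{F/ℚ} E_F ∼ E × (E ⊗ ρ)` is the same for `E` and `E^{(D)}` and drops out. [folklore] -/
theorem sha_sq_identity (hmod : hasEntireLFunction_rat)
    (hMilneC : Milne1972.bsdQuotient_baseChange_quadratic_anyModel)
    (hDD : DokchitserDokchitser2010.bsdQuotient_brauerS3_anyModel) (hArtin : LSeries_brauerS3)
    (hBC3 : hasEntireLFunction_baseChange_cubic)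
    (hBC6 : hasEntireLFunction_baseChange_of_isGalois_six)
    (hK2 : Module.finrank ℚ K = 2) (hF3 : Module.finrank ℚ F = 3) {f : ℤ} (hf : f ≠ 0)
    (hdisc : NumberField.discr F = NumberField.discr K * f ^ 2)
    (hL6 : Module.finrank ℚ L = 6) (hGal : IsGalois ℚ L)
    (hWd : ∃ C : VariableChange ℚ, C • W.quadraticTwist (NumberField.discr K : ℚ) = Wd)
    (hVF : ∃ C : VariableChange F, C • W.baseChange F = VF)
    (hVF' : ∃ C : VariableChange F, C • Wd.baseChange F = VF')
    (hshaW : W.ShaFinite) (hshaWd : Wd.ShaFinite) (hshaF : VF.ShaFinite)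
    (hshaF' : VF'.ShaFinite) :
    (shaAn W * shaAnOverC VF' * (Wd.shaOrder : ℂ) * (VF.shaOrder : ℂ)) ^ 2 =
      (shaAn Wd * shaAnOverC VF * (W.shaOrder : ℂ) * (VF'.shaOrder : ℂ)) ^ 2 := by
  -- the four product formulas `#Ш_an · quotient = ℓ · #Ш`
  have P1 := shaAn_mul_bsdRHS W
  have P1' := shaAn_mul_bsdRHS Wd
  have P2 := shaAnOverC_mul_quotient (M := F) VF
  have P2' := shaAnOverC_mul_quotient (M := F) VF'
  -- the two sides
  have hAlg := quotient_sq_eq W Wd K F L VF VF' hMilneC hDD hK2 hF3 hf hdisc hL6 hGal hWd hVF hVF'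
    hshaW hshaWd hshaF hshaF'
  have hAn := leadingLCoeff_sq_mul_sq_eq W Wd K F L VF VF' hmod hArtin hBC3 hBC6 hK2 hF3 hf hdisc
    hL6 hGal hWd hVF hVF'
  -- abbreviations (real quotients, cast to `ℂ`)
  set A : ℝ := (VF.shaOrder : ℝ) * VF.regulator * VF.bsdPeriod * (VF.modifiedTamagawaProduct : ℝ) /
    (VF.torsionOrder : ℝ) ^ 2 with hA
  set A' : ℝ := (VF'.shaOrder : ℝ) * VF'.regulator * VF'.bsdPeriod *
    (VF'.modifiedTamagawaProduct : ℝ) / (VF'.torsionOrder : ℝ) ^ 2 with hA'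
  have hY : ((W.bsdRHS : ℂ) * (A' : ℂ)) ^ 2 ≠ 0 := by
    have h1 : (W.bsdRHS : ℂ) ≠ 0 := by exact_mod_cast (W.bsdRHS_pos' hshaW).ne'
    have h2 : (A' : ℂ) ≠ 0 := Complex.ofReal_ne_zero.mpr (quotient_pos (M := F) VF' hshaF').ne'
    exact pow_ne_zero _ (mul_ne_zero h1 h2)
  have hAlgC : ((A : ℂ) * (Wd.bsdRHS : ℂ)) ^ 2 = ((W.bsdRHS : ℂ) * (A' : ℂ)) ^ 2 := by
    have h := congrArg (fun x : ℝ => (x : ℂ)) hAlg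
    simpa only [Complex.ofReal_pow, Complex.ofReal_mul] using h
  apply mul_right_cancel₀ hY
  calc (shaAn W * shaAnOverC VF' * (Wd.shaOrder : ℂ) * (VF.shaOrder : ℂ)) ^ 2 *
        ((W.bsdRHS : ℂ) * (A' : ℂ)) ^ 2
      = ((shaAn W * (W.bsdRHS : ℂ)) * (shaAnOverC VF' * (A' : ℂ))) ^ 2 *
          ((Wd.shaOrder : ℂ) * (VF.shaOrder : ℂ)) ^ 2 := by ring
    _ = ((W.leadingLCoeff * (W.shaOrder : ℂ)) * (VF'.leadingLCoeff * (VF'.shaOrder : ℂ))) ^ 2 *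
          ((Wd.shaOrder : ℂ) * (VF.shaOrder : ℂ)) ^ 2 := by rw [P1, P2']
    _ = ((Wd.leadingLCoeff * (Wd.shaOrder : ℂ)) * (VF.leadingLCoeff * (VF.shaOrder : ℂ))) ^ 2 *
          ((W.shaOrder : ℂ) * (VF'.shaOrder : ℂ)) ^ 2 := by
        linear_combination
          (-(((W.shaOrder : ℂ) * (VF'.shaOrder : ℂ) * (Wd.shaOrder : ℂ) * (VF.shaOrder : ℂ)) ^ 2)) *
            hAn
    _ = ((shaAn Wd * (Wd.bsdRHS : ℂ)) * (shaAnOverC VF * (A : ℂ))) ^ 2 *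
          ((W.shaOrder : ℂ) * (VF'.shaOrder : ℂ)) ^ 2 := by rw [P1', P2]
    _ = (shaAn Wd * shaAnOverC VF * (W.shaOrder : ℂ) * (VF'.shaOrder : ℂ)) ^ 2 *
          ((A : ℂ) * (Wd.bsdRHS : ℂ)) ^ 2 := by ring
    _ = (shaAn Wd * shaAnOverC VF * (W.shaOrder : ℂ) * (VF'.shaOrder : ℂ)) ^ 2 *
          ((W.bsdRHS : ℂ) * (A' : ℂ)) ^ 2 := by rw [hAlgC]

end Main

end Summit.BirchSwinnertonDyer.BirchSwinnertonDyer.Theorems.CubicResolvent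

end
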